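import Literature.MathematicalPhysics.QuantumLattice.FockRelabel
import HarnessLib

/-!
# The plaquette space group of the breathing (plaquette / checkerboard) Hubbard torus

Topic `MathematicalPhysics/QuantumLattice`, family `hubbard`; companion of
`PlaquetteBreathingSelfDuality` (written for the crux `CooperPairDMott` of route
`CooperPairDMottWalk`, summit `HubbardSuperconductivity`: symmetry of the sector ground states of
the breathing family, and the selection rules of the sequel file `PlaquetteBreathingSelectionRules`).
The breathing Hamiltonian `H_L(a,b,U) = hamiltonian (G ∖ P) a U + hamiltonian (G ⊓ P) b 0` (`G` the
torus graph, `P` = "different `2 × 2` plaquette `{2m,2m+1}²`"; verbatim the route's `Hb L a b U`)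
is invariant under every site bijection which is a torus-graph automorphism preserving the relation
"same plaquette" (`relabel_mapEquiv_breathing`, from `relabel_hamiltonian` applied to both bond
classes). For EVEN `L` the space-group elements `x ↦ γ(x + v)` (unitaries
`U_γ U_v = fockD4 γ * fockTranslate v` of `FockRelabel`) qualify in the three generating cases of
the plaquette space group `(2ℤ/Lℤ)² ⋊ D₄`: the plaquette translations `x ↦ x + 2eⱼ`
(`plaq_translate_two_single`), the plaquette-CENTRED quarter rotation
`x ↦ (1 - x₂, x₁) = r(x - e₂)` (`plaq_plaquetteRot`) and the plaquette-centred axis reflection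
`x ↦ (x₁, 1 - x₂) = s(x - e₂)` (`plaq_plaquetteRefl`) — the only input is the arithmetic of the
half-label `n ↦ n / 2` on `ℤ/Lℤ` (`halfLabel_add_two`, `halfLabel_one_sub`). Hence these unitaries
commute with `H_L(a,b,U)` and transport its sector ground states
(`isGroundStateInSector_spaceGroup_mulVec_breathing`). (The SITE-centred `D₄` of `hubbardTorus` is
NOT a symmetry of the breathing family, and the diagonal translation `x ↦ x + (1,1)` swaps `a ↔ b`,
`PlaquetteBreathingSelfDuality`.)

Sources: W.-F. Tsai, S. A. Kivelson, Phys. Rev. B 73 (2006) 214510 and H. Yao, W.-F. Tsai,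
S. A. Kivelson, Phys. Rev. B 76 (2007) 161104 (checkerboard Hubbard model and its plaquette
lattice); Bratteli–Robinson II §5.2.2 (implementing unitaries) [BratteliRobinsonII1997]. Folklore
bookkeeping; no definition and no named fact is introduced.
-/

noncomputable section

namespace Literature.MathematicalPhysics.QuantumLattice

open Matrix Finset
open Literature.Probability.LatticeModels

/-! ### Arithmetic of the plaquette half-label `n ↦ n / 2` on `ℤ/Lℤ`, `L` even -/

section HalfLabel

/-- Translation by two steps along the cycle `ℤ/Lℤ` (`L` even) permutes the plaquette half-labels:
`(n+2 mod L)/2 = (n'+2 mod L)/2 ↔ n/2 = n'/2`. [folklore] -/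
theorem halfLabel_add_two {L n n' : ℕ} (hL : Even L) (hn : n < L) (hn' : n' < L) :
    ((n + 2) % L) / 2 = ((n' + 2) % L) / 2 ↔ n / 2 = n' / 2 := by
  obtain ⟨k, hk⟩ := hL
  have key : ∀ m, m < L → ((m + 2) % L) / 2 = if m / 2 + 1 < k then m / 2 + 1 else 0 := by
    intro m hm
    rcases Nat.lt_or_ge (m + 2) L with h2 | h2
    · rw [Nat.mod_eq_of_lt h2, if_pos (by omega)]
      omega
    · rw [Nat.mod_eq_sub_mod h2, Nat.mod_eq_of_lt (by omega), if_neg (by omega)]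
      omega
  rw [key n hn, key n' hn']
  constructor
  · intro h
    split_ifs at h <;> omega
  · intro h
    rw [h]

/-- The plaquette-centred flip `n ↦ 1 - n` of the cycle `ℤ/Lℤ` (`L` even), i.e.
`n ↦ (L + 1 - n) mod L` on representatives, permutes the plaquette half-labels:
`{0,1} ↦ {1,0}`, `{2q, 2q+1} ↦ {L-2q+1, L-2q}`. [folklore] -/
theorem halfLabel_one_sub {L n n' : ℕ} (hL : Even L) (hn : n < L) (hn' : n' < L) :
    ((L + 1 - n) % L) / 2 = ((L + 1 - n') % L) / 2 ↔ n / 2 = n' / 2 := by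
  obtain ⟨k, hk⟩ := hL
  have key : ∀ m, m < L → ((L + 1 - m) % L) / 2 = if m / 2 = 0 then 0 else k - m / 2 := by
    intro m hm
    rcases Nat.lt_or_ge m 2 with h2 | h2
    · rw [if_pos (by omega)]
      interval_cases m
      · rw [Nat.sub_zero, Nat.add_mod_left, Nat.mod_eq_of_lt (by omega : 1 < L)]
      · rw [Nat.add_sub_cancel, Nat.mod_self]
    · rw [if_neg (by omega), Nat.mod_eq_of_lt (by omega)]
      omega
  rw [key n hn, key n' hn']
  constructor
  · intro h
    split_ifs at h <;> omega
  · intro h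
    rw [h]

end HalfLabel

/-! ### Coordinates of translated / rotated / reflected sites of the fermionic torus -/

/-- The PLAQUETTE-CENTRED quarter rotation `x ↦ (1 - x₂, x₁)` of the torus `(ℤ/Lℤ)²` (rotation by
`π/2` about the centre `(½, ½)` of the plaquette `{0,1}²`), as the space-group element
`rot ∘ (x ↦ x - e₂) = d4SitePerm (r 1) * addRight (-e₂)`. -/
local notation "plaqRot[" L "]" =>
  ((d4SitePerm (DihedralGroup.r 1) : Equiv.Perm (TorusSite 2 L)) *
    Equiv.addRight (-(Pi.single 1 1 : TorusSite 2 L)))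

/-- The PLAQUETTE-CENTRED axis reflection `x ↦ (x₁, 1 - x₂)`, as the space-group element
`refl ∘ (x ↦ x - e₂) = d4SitePerm (sr 0) * addRight (-e₂)`. -/
local notation "plaqRefl[" L "]" =>
  ((d4SitePerm (DihedralGroup.sr 0) : Equiv.Perm (TorusSite 2 L)) *
    Equiv.addRight (-(Pi.single 1 1 : TorusSite 2 L)))

section Coordinates

variable {L : ℕ}

/-- `val (1 - n) = (L + 1 - n) mod L` in `ℤ/Lℤ` for `n < L`. [folklore] -/
theorem val_one_sub_natCast {n : ℕ} (hn : n < L) :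
    ((1 : ZMod L) - (n : ZMod L)).val = (L + 1 - n) % L := by
  have h : ((L + 1 - n : ℕ) : ZMod L) = 1 - (n : ZMod L) := by
    rw [Nat.cast_sub (by omega), Nat.cast_add, ZMod.natCast_self, zero_add, Nat.cast_one]
  rw [← h, ZMod.val_natCast]

/-- The plaquette-centred rotation on torus sites: `X ↦ (1 - X₂, X₁)`. [folklore] -/
theorem plaquetteRot_apply (X : TorusSite 2 L) : plaqRot[L] X = ![1 - X 1, X 0] := by
  rw [Equiv.Perm.mul_apply, Equiv.coe_addRight, d4SitePerm_apply]
  show rotSite (X + -(Pi.single 1 1)) = _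
  funext k
  fin_cases k
  · simp [rotSite, sub_eq_add_neg, add_comm]
  · simp [rotSite]

/-- The plaquette-centred reflection on torus sites: `X ↦ (X₁, 1 - X₂)`. [folklore] -/
theorem plaquetteRefl_apply (X : TorusSite 2 L) : plaqRefl[L] X = ![X 0, 1 - X 1] := by
  rw [Equiv.Perm.mul_apply, Equiv.coe_addRight, d4SitePerm_apply]
  show reflSite (rotSite^[0] (X + -(Pi.single 1 1))) = _
  funext k
  fin_cases k
  · simp [reflSite]
  · simp [reflSite, sub_eq_add_neg, add_comm]

variable [NeZero L]

/-- `ℕ`-coordinates of the image of a site under a torus bijection: `(g x)ᵢ = val (g X)ᵢ`,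
`X = toTorusSite x`. [folklore] -/
theorem ofLex_ofTorusEquiv_apply (g : TorusSite 2 L ≃ TorusSite 2 L) (x : FermionTorus 2 L)
    (i : Fin 2) :
    (ofLex (FermionTorus.ofTorusEquiv g x) i : ℕ) = (g (FermionTorus.toTorusSite x) i).val := by
  rw [FermionTorus.ofTorusEquiv_apply, FermionTorus.ofLex_ofTorusSite_apply]

/-- `ℕ`-coordinates of a translate: `(x + v)ᵢ = (xᵢ + val vᵢ) mod L`. [folklore] -/
theorem ofLex_ofTorusEquiv_addRight_apply (v : TorusSite 2 L) (x : FermionTorus 2 L) (i : Fin 2) :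
    (ofLex (FermionTorus.ofTorusEquiv (Equiv.addRight v) x) i : ℕ) =
      ((ofLex x i : ℕ) + (v i).val) % L := by
  rw [ofLex_ofTorusEquiv_apply, Equiv.coe_addRight]
  dsimp only
  rw [Pi.add_apply, FermionTorus.toTorusSite_apply, ZMod.val_add, ZMod.val_natCast,
    Nat.mod_eq_of_lt (ofLex x i).isLt]

/-- `ℕ`-coordinates of the plaquette-centred rotation: `((L + 1 - x₂) mod L, x₁)`. [folklore] -/
theorem ofLex_plaquetteRot (x : FermionTorus 2 L) :
    ((ofLex (FermionTorus.ofTorusEquiv plaqRot[L] x) 0 : ℕ) = (L + 1 - (ofLex x 1 : ℕ)) % L) ∧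
    ((ofLex (FermionTorus.ofTorusEquiv plaqRot[L] x) 1 : ℕ) = (ofLex x 0 : ℕ)) := by
  refine ⟨?_, ?_⟩
  · rw [ofLex_ofTorusEquiv_apply, plaquetteRot_apply, Matrix.cons_val_zero,
      FermionTorus.toTorusSite_apply, val_one_sub_natCast (ofLex x 1).isLt]
  · rw [ofLex_ofTorusEquiv_apply, plaquetteRot_apply, Matrix.cons_val_one, Matrix.cons_val_zero,
      FermionTorus.toTorusSite_apply, ZMod.val_natCast, Nat.mod_eq_of_lt (ofLex x 0).isLt]

/-- `ℕ`-coordinates of the plaquette-centred reflection: `(x₁, (L + 1 - x₂) mod L)`. [folklore] -/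
theorem ofLex_plaquetteRefl (x : FermionTorus 2 L) :
    ((ofLex (FermionTorus.ofTorusEquiv plaqRefl[L] x) 0 : ℕ) = (ofLex x 0 : ℕ)) ∧
    ((ofLex (FermionTorus.ofTorusEquiv plaqRefl[L] x) 1 : ℕ) = (L + 1 - (ofLex x 1 : ℕ)) % L) := by
  refine ⟨?_, ?_⟩
  · rw [ofLex_ofTorusEquiv_apply, plaquetteRefl_apply, Matrix.cons_val_zero,
      FermionTorus.toTorusSite_apply, ZMod.val_natCast, Nat.mod_eq_of_lt (ofLex x 0).isLt]
  · rw [ofLex_ofTorusEquiv_apply, plaquetteRefl_apply, Matrix.cons_val_one, Matrix.cons_val_zero,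
      FermionTorus.toTorusSite_apply, val_one_sub_natCast (ofLex x 1).isLt]

end Coordinates

/-! ### The plaquette relation is preserved by the plaquette space group (`L` even) -/

section PlaquetteCompat

variable {L : ℕ} [NeZero L]

/-- **Even translations preserve the plaquette tiling** (`L` even): `x ↦ x + 2eⱼ` maps sites of a
common plaquette `{2m,2m+1}²` to sites of a common plaquette, and conversely. [folklore] -/
theorem plaq_translate_two_single (hL : Even L) (j : Fin 2) (x y : FermionTorus 2 L) :
    ((fun i : Fin 2 => (ofLex (FermionTorus.ofTorusEquiv
        (Equiv.addRight (Pi.single j ((2 : ℕ) : ZMod L))) x) i : ℕ) / 2) =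
        fun i : Fin 2 => (ofLex (FermionTorus.ofTorusEquiv
        (Equiv.addRight (Pi.single j ((2 : ℕ) : ZMod L))) y) i : ℕ) / 2) ↔
      ((fun i : Fin 2 => (ofLex x i : ℕ) / 2) = fun i : Fin 2 => (ofLex y i : ℕ) / 2) := by
  have hcoord : ∀ (z : FermionTorus 2 L) (i : Fin 2),
      (ofLex (FermionTorus.ofTorusEquiv (Equiv.addRight (Pi.single j ((2 : ℕ) : ZMod L))) z) i : ℕ) =
        if i = j then ((ofLex z i : ℕ) + 2) % L else (ofLex z i : ℕ) := by
    intro z i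
    rw [ofLex_ofTorusEquiv_addRight_apply]
    by_cases hij : i = j
    · subst hij
      rw [if_pos rfl, Pi.single_eq_same, ZMod.val_natCast, Nat.add_mod_mod]
    · rw [if_neg hij, Pi.single_eq_of_ne hij, ZMod.val_zero, add_zero,
        Nat.mod_eq_of_lt (ofLex z i).isLt]
  simp only [funext_iff, hcoord]
  constructor
  · intro h i
    have hi := h i
    by_cases hij : i = j
    · rw [if_pos hij, if_pos hij] at hi
      exact (halfLabel_add_two hL (ofLex x i).isLt (ofLex y i).isLt).1 hi
    · rwa [if_neg hij, if_neg hij] at hi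
  · intro h i
    by_cases hij : i = j
    · rw [if_pos hij, if_pos hij]
      exact (halfLabel_add_two hL (ofLex x i).isLt (ofLex y i).isLt).2 (h i)
    · rw [if_neg hij, if_neg hij]
      exact h i

/-- **The plaquette-centred rotation preserves the plaquette tiling** (`L` even). [folklore] -/
theorem plaq_plaquetteRot (hL : Even L) (x y : FermionTorus 2 L) :
    ((fun i : Fin 2 => (ofLex (FermionTorus.ofTorusEquiv plaqRot[L] x) i : ℕ) / 2) =
        fun i : Fin 2 => (ofLex (FermionTorus.ofTorusEquiv plaqRot[L] y) i : ℕ) / 2) ↔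
      ((fun i : Fin 2 => (ofLex x i : ℕ) / 2) = fun i : Fin 2 => (ofLex y i : ℕ) / 2) := by
  rw [funext_iff, funext_iff, Fin.forall_fin_two, Fin.forall_fin_two, (ofLex_plaquetteRot x).1,
    (ofLex_plaquetteRot x).2, (ofLex_plaquetteRot y).1, (ofLex_plaquetteRot y).2,
    halfLabel_one_sub hL (ofLex x 1).isLt (ofLex y 1).isLt, and_comm]

/-- **The plaquette-centred reflection preserves the plaquette tiling** (`L` even). [folklore] -/
theorem plaq_plaquetteRefl (hL : Even L) (x y : FermionTorus 2 L) :
    ((fun i : Fin 2 => (ofLex (FermionTorus.ofTorusEquiv plaqRefl[L] x) i : ℕ) / 2) =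
        fun i : Fin 2 => (ofLex (FermionTorus.ofTorusEquiv plaqRefl[L] y) i : ℕ) / 2) ↔
      ((fun i : Fin 2 => (ofLex x i : ℕ) / 2) = fun i : Fin 2 => (ofLex y i : ℕ) / 2) := by
  rw [funext_iff, funext_iff, Fin.forall_fin_two, Fin.forall_fin_two, (ofLex_plaquetteRefl x).1,
    (ofLex_plaquetteRefl x).2, (ofLex_plaquetteRefl y).1, (ofLex_plaquetteRefl y).2,
    halfLabel_one_sub hL (ofLex x 1).isLt (ofLex y 1).isLt]

end PlaquetteCompat

/-! ### The breathing Hamiltonian is invariant under the plaquette space group -/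

/-- The "different plaquette" relation `P` on the fermionic torus, as in the route statement. -/
local notation "Pq[" L "]" =>
  (SimpleGraph.comap (fun (x : FermionTorus 2 L) (i : Fin 2) => (ofLex x i : ℕ) / 2)
    (⊤ : SimpleGraph (Fin 2 → ℕ)))

/-- The breathing Hamiltonian `H_L(a, b, U)`, verbatim the route's `Hb L a b U`. -/
local notation "Hb[" L "," a "," b "," U "]" =>
  (hamiltonian (fermionTorusGraph 2 L \ Pq[L]) a U + hamiltonian (fermionTorusGraph 2 L ⊓ Pq[L]) b 0)

section Breathing

variable {L : ℕ} [NeZero L]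

omit [NeZero L] in
/-- **Covariance of the breathing Hamiltonian.** A site bijection `g` of the torus which is an
automorphism of the nearest-neighbour graph AND preserves the relation "same `2 × 2` plaquette"
(on adjacent pairs) fixes `H_L(a,b,U)` under the induced Fock-space relabelling:
`Γ_g H_L(a,b,U) Γ_g⁻¹ = H_L(a,b,U)` (both bond classes, intra and inter, are `g`-invariant).
[folklore] -/
theorem relabel_mapEquiv_breathing (g : Equiv.Perm (FermionTorus 2 L))
    (hG : ∀ x y, (fermionTorusGraph 2 L).Adj (g x) (g y) ↔ (fermionTorusGraph 2 L).Adj x y)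
    (hP : ∀ x y, (fermionTorusGraph 2 L).Adj x y →
      (((fun i : Fin 2 => (ofLex (g x) i : ℕ) / 2) = fun i : Fin 2 => (ofLex (g y) i : ℕ) / 2) ↔
        ((fun i : Fin 2 => (ofLex x i : ℕ) / 2) = fun i : Fin 2 => (ofLex y i : ℕ) / 2)))
    (a b U : ℝ) :
    relabel (Orb.mapEquiv g) Hb[L,a,b,U] = Hb[L,a,b,U] := by
  have h1 : ∀ x y, (fermionTorusGraph 2 L \ Pq[L]).Adj (g x) (g y) ↔
      (fermionTorusGraph 2 L \ Pq[L]).Adj x y := by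
    intro x y
    simp only [SimpleGraph.sdiff_adj, SimpleGraph.comap_adj, SimpleGraph.top_adj]
    rw [hG x y]
    exact and_congr_right fun hxy => not_congr (not_congr (hP x y hxy))
  have h2 : ∀ x y, (fermionTorusGraph 2 L ⊓ Pq[L]).Adj (g x) (g y) ↔
      (fermionTorusGraph 2 L ⊓ Pq[L]).Adj x y := by
    intro x y
    simp only [SimpleGraph.inf_adj, SimpleGraph.comap_adj, SimpleGraph.top_adj]
    rw [hG x y]
    exact and_congr_right fun hxy => not_congr (hP x y hxy)
  rw [relabel_add, relabel_hamiltonian _ _ _ h1 a U, relabel_hamiltonian _ _ _ h2 b 0]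

/-- The space-group elements `(γ, v)`, `x ↦ γ(x + v)`, are automorphisms of the torus graph.
[folklore] -/
theorem fermionTorusGraph_adj_spaceGroup (γ : DihedralGroup 4) (v : TorusSite 2 L)
    (x y : FermionTorus 2 L) :
    (fermionTorusGraph 2 L).Adj
        (FermionTorus.ofTorusEquiv ((d4SitePerm γ : Equiv.Perm (TorusSite 2 L)) * Equiv.addRight v) x)
        (FermionTorus.ofTorusEquiv ((d4SitePerm γ : Equiv.Perm (TorusSite 2 L)) * Equiv.addRight v) y) ↔
      (fermionTorusGraph 2 L).Adj x y := by
  rw [FermionTorus.ofTorusEquiv_mul, Equiv.Perm.mul_apply, Equiv.Perm.mul_apply,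
    fermionTorusGraph_adj_d4SitePerm, fermionTorusGraph_adj_addRight]

/-- The orbital permutation of the space-group unitary `U_γ U_v`:
`d4Perm γ ∘ translate v = mapEquiv (x ↦ γ(x + v))`. [folklore] -/
theorem d4Perm_mul_translate_eq_mapEquiv (γ : DihedralGroup 4) (v : TorusSite 2 L) :
    Orb.d4Perm (L := L) γ * Orb.translate v =
      Orb.mapEquiv (FermionTorus.ofTorusEquiv ((d4SitePerm γ : Equiv.Perm (TorusSite 2 L)) *
        Equiv.addRight v)) := by
  rw [Orb.d4Perm_eq_mapEquiv, Orb.translate, FermionTorus.ofTorusEquiv_mul, ← Orb.mapPerm_apply,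
    ← Orb.mapPerm_apply, ← Orb.mapPerm_apply, ← map_mul]

/-- The space-group unitary `U_γ U_v = fockD4 γ * fockTranslate v` is the Fock relabelling of the
site bijection `x ↦ γ(x + v)`. [folklore] -/
theorem fockD4_mul_fockTranslate_val (γ : DihedralGroup 4) (v : TorusSite 2 L) :
    (fockD4 (L := L) γ).val * (fockTranslate v).val =
      (fockRelabel (Orb.mapEquiv (FermionTorus.ofTorusEquiv
        ((d4SitePerm γ : Equiv.Perm (TorusSite 2 L)) * Equiv.addRight v)))).val := by
  rw [← d4Perm_mul_translate_eq_mapEquiv, map_mul, fockD4_apply]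
  rfl

/-- **Invariance of the breathing Hamiltonian under the PLAQUETTE space group.** If the
space-group element `x ↦ γ(x + v)` preserves the relation "same plaquette", then
`U H_L(a,b,U) U⁻¹ = H_L(a,b,U)` for `U = U_γ U_v`. [folklore] -/
theorem relabel_spaceGroup_breathing (γ : DihedralGroup 4) (v : TorusSite 2 L)
    (hP : ∀ x y : FermionTorus 2 L,
      ((fun i : Fin 2 => (ofLex (FermionTorus.ofTorusEquiv
          ((d4SitePerm γ : Equiv.Perm (TorusSite 2 L)) * Equiv.addRight v) x) i : ℕ) / 2) =
        fun i : Fin 2 => (ofLex (FermionTorus.ofTorusEquiv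
          ((d4SitePerm γ : Equiv.Perm (TorusSite 2 L)) * Equiv.addRight v) y) i : ℕ) / 2) ↔
      ((fun i : Fin 2 => (ofLex x i : ℕ) / 2) = fun i : Fin 2 => (ofLex y i : ℕ) / 2))
    (a b U : ℝ) :
    relabel (Orb.mapEquiv (FermionTorus.ofTorusEquiv
        ((d4SitePerm γ : Equiv.Perm (TorusSite 2 L)) * Equiv.addRight v))) Hb[L,a,b,U] =
      Hb[L,a,b,U] :=
  relabel_mapEquiv_breathing _ (fermionTorusGraph_adj_spaceGroup γ v) (fun x y _ => hP x y) a b U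

/-- **The plaquette space group transports sector ground states of the breathing Hamiltonian**:
under the hypothesis of `relabel_spaceGroup_breathing`, `U_γ U_v ψ` is a ground state of
`H_L(a,b,U)` in `(N, S^z = M)` whenever `ψ` is. [folklore] -/
theorem isGroundStateInSector_spaceGroup_mulVec_breathing (γ : DihedralGroup 4) (v : TorusSite 2 L)
    (hP : ∀ x y : FermionTorus 2 L,
      ((fun i : Fin 2 => (ofLex (FermionTorus.ofTorusEquiv
          ((d4SitePerm γ : Equiv.Perm (TorusSite 2 L)) * Equiv.addRight v) x) i : ℕ) / 2) =
        fun i : Fin 2 => (ofLex (FermionTorus.ofTorusEquiv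
          ((d4SitePerm γ : Equiv.Perm (TorusSite 2 L)) * Equiv.addRight v) y) i : ℕ) / 2) ↔
      ((fun i : Fin 2 => (ofLex x i : ℕ) / 2) = fun i : Fin 2 => (ofLex y i : ℕ) / 2))
    (a b U : ℝ) {N : ℕ} {M : ℝ} {ψ : Fock (Orb (FermionTorus 2 L))}
    (hψ : IsGroundStateInSector Hb[L,a,b,U] N M ψ) :
    IsGroundStateInSector Hb[L,a,b,U] N M (((fockD4 (L := L) γ).val * (fockTranslate v).val) *ᵥ ψ) := by
  rw [fockD4_mul_fockTranslate_val]
  exact hψ.fockRelabel_mapEquiv_mulVec _ (relabel_spaceGroup_breathing γ v hP a b U)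

/-! #### The three generators of the plaquette space group `(2ℤ)² ⋊ D₄` -/

/-- **Plaquette translations** `x ↦ x + 2eⱼ` (`γ = 1`): compatible for even `L`. [folklore] -/
theorem plaq_spaceGroup_translate_two_single (hL : Even L) (j : Fin 2) (x y : FermionTorus 2 L) :
    ((fun i : Fin 2 => (ofLex (FermionTorus.ofTorusEquiv
        ((d4SitePerm 1 : Equiv.Perm (TorusSite 2 L)) *
          Equiv.addRight (Pi.single j ((2 : ℕ) : ZMod L))) x) i : ℕ) / 2) =
      fun i : Fin 2 => (ofLex (FermionTorus.ofTorusEquiv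
        ((d4SitePerm 1 : Equiv.Perm (TorusSite 2 L)) *
          Equiv.addRight (Pi.single j ((2 : ℕ) : ZMod L))) y) i : ℕ) / 2) ↔
    ((fun i : Fin 2 => (ofLex x i : ℕ) / 2) = fun i : Fin 2 => (ofLex y i : ℕ) / 2) := by
  rw [map_one, one_mul]
  exact plaq_translate_two_single hL j x y

end Breathing


end Literature.MathematicalPhysics.QuantumLattice

end
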